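/-
Copyright (c) 2026 the pub-hodgecm-mathlib formalisation cell (harness21).  Prover seat hodgecm-mathlib-K2Liu-p07 (g2): Track B «K2-LIT»,
#184♮ = hLiu418 = stmt-HodgeConjecture-24832; LEAD F0P6-plan (g10) DEAL 2026-09-03T23:43:04Z «B2»; REPORT-FIRST B2 6770f1399d2dee2a, file B2c-i; 2026-09-04.
-/
import Summits.HodgeConjecture.HodgeConjecture.Theorems.K2LiuSiegelBruhatMiddleCellDelta
import HarnessLib

/-!
# Crux `HLiu418`, road `K2_Liu`, organ O41.1 part B2 (file B2c-i): the RANK-ONE SIGN INVOLUTION `g = diag(1,…,−1,…,1) ∈ G₁(L⁺)` —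
# existence of the middle-cell representative `w₁ = ι(1, g)` for `n = 2`, and its corner condition `X_{k₀k₀} = 0`

Cell `hodgecm-mathlib`, crux item hLiu418 = `stmt-HodgeConjecture-24832`; prover K2Liu-p07 (g2).  THEOREMS ONLY; imports ★ B2b; lane
`--supports stmt-HodgeConjecture-24832 --as helper`.

For the diagonal hermitian data `J_V ⊗ J_W = diag(dV) ⊗ diag(dW)` of the K2_Liu frame, every diagonal SIGN matrix `s = diag(σ)`, `σ_k = −1` at one index
`k₀` and `+1` elsewhere, is a rational point of `G₁ = U(J_V ⊗ J_W)` (`(c s)ᵀ J s = s J s = J`: diagonal matrices commute, `σ² = 1`, `c(±1) = ±1`) and an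
involution; `1 − s = 2 e_{k₀} e_{k₀}ᵀ` has rank one.  So `w₁ := ι(1, s ⊗ 1)` (★ B2b) represents the rank-one cell of `P_Δ\H/P_Δ` — for `n = 2` THE middle
cell (p02's sketch «`w_r := ι(1, g_r)`, `rank(g_r − 1) = r`», here `r = 1`).
* §1 `signMatrix_mul_self`, `signMatrix_map`, **`exists_signPair`**: `∃ γ ∈ G₁(L⁺)` with matrix `diag(σ)` and `γ² = 1`.
* §2 for such `γ` (adelic image `g`, `G = reindex e g = diag(σ ∘ e⁻¹)` over `𝔸_L`): **`cornerCondition_sign_iff`**: `(1 − G) X (1 − G) = 0 ⟺ X (e k₀) (e k₀) = 0` —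
  with ★ B2b `isSiegelDelta_conj_unip_iff`: **the stabiliser `N_{w₁}` of `P_Δ w₁` under the right `N_Δ`-action is the hyperplane `{X_{k₀k₀} = 0}` of
  `N_Δ ≅ Herm_n`** (n = 2: codimension 1 in the 4-dimensional `Herm₂(L/L⁺)`), the datum REPORT-FIRST B2 (C3) promised; `reindex_sign_ne_one`
  (`G ≠ 1`, so `w₁ ∉ P_Δ` by ★ B2b).
[GelbartPiatetskishapiroRallis1987, Part A §§1–2], [KudlaRallis1994, §1], [MoeglinWaldspurger1995, II.1.7].
HONEST LABEL.  Count-neutral helper; `HC_CM` is proved only modulo the 7 printed citations (hLiu418 = 24832, h413 = 24833) until rung 0 closes.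
-/

set_option autoImplicit false
set_option linter.dupNamespace false -- the mandated namespace repeats `HodgeConjecture.HodgeConjecture`

noncomputable section

open scoped Matrix Kronecker
open NumberField IsDedekindDomain
open Literature.NumberTheory.Automorphic Literature.NumberTheory.GaloisRepresentations
open Literature.NumberTheory.GelbartRogawski1991 Literature.NumberTheory.GelbartRogawski1991.GRConstruction
open Literature.NumberTheory.K2Lit.SiegelDoubled

namespace Summit.HodgeConjecture.HodgeConjecture.Cruxes.HLiu418.K2LiuSiegelReflectionSign

open K2LiuSiegelBruhatMiddleCellDelta

variable (L : Type) [Field L] [NumberField L] [IsCMField L]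
variable {N M n : ℕ} (e : Fin N × Fin M ≃ Fin n)
  (dV : Fin N → L) (hdV : ∀ i, IsCMField.complexConj L (dV i) = dV i)
  (dW : Fin M → L) (hdW : ∀ i, IsCMField.complexConj L (dW i) = dW i)

/-! ## §1 The sign matrix `diag(σ)` is a rational involution of `G₁` -/

omit [NumberField L] [IsCMField L] in
/-- `diag(σ)² = 1` for a `±1`-valued `σ`. [folklore] -/
theorem signMatrix_mul_self (k₀ : Fin N × Fin M) :
    Matrix.diagonal (fun k : Fin N × Fin M => if k = k₀ then (-1 : L) else 1) *
        Matrix.diagonal (fun k : Fin N × Fin M => if k = k₀ then (-1 : L) else 1) = 1 := by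
  rw [Matrix.diagonal_mul_diagonal, ← Matrix.diagonal_one]
  congr 1
  funext k
  split_ifs <;> simp

/-- `c(diag(σ)) = diag(σ)`: the entries `±1` are fixed by the conjugation. [folklore] -/
theorem signMatrix_map (k₀ : Fin N × Fin M) :
    (Matrix.diagonal (fun k : Fin N × Fin M => if k = k₀ then (-1 : L) else 1)).map ((IsCMField.complexConj L : L ≃ₐ[Fp L] L) : L →+* L) =
      Matrix.diagonal (fun k : Fin N × Fin M => if k = k₀ then (-1 : L) else 1) := by
  rw [Matrix.diagonal_map (map_zero _)]
  congr 1
  funext k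
  show ((IsCMField.complexConj L : L ≃ₐ[Fp L] L) : L →+* L) (if k = k₀ then (-1 : L) else 1) = _
  split_ifs <;> simp

/-- **The rank-one sign involution of `G₁(L⁺)` exists**: for every index `k₀` there is `γ ∈ G₁(L⁺) = U(diag dV ⊗ diag dW)(L⁺)` whose matrix is
`diag(σ)` (`σ_{k₀} = −1`, `σ = 1` elsewhere) and `γ² = 1`.  (Membership: `(cγ)ᵀ J γ = diag(σ) diag(dV ⊗ dW) diag(σ) = diag(dV ⊗ dW)`.)
[cite: GelbartPiatetskishapiroRallis1987, Part A §1] -/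
theorem exists_signPair (k₀ : Fin N × Fin M) :
    ∃ γ : UnitaryGroup.rationalPair (Fp L) L (IsCMField.complexConj L) N M (Matrix.diagonal dV) (Matrix.diagonal dW),
      ((γ : GL (Fin N × Fin M) L) : Matrix (Fin N × Fin M) (Fin N × Fin M) L) =
          Matrix.diagonal (fun k : Fin N × Fin M => if k = k₀ then (-1 : L) else 1) ∧
        γ * γ = 1 := by
  set s : Matrix (Fin N × Fin M) (Fin N × Fin M) L := Matrix.diagonal (fun k : Fin N × Fin M => if k = k₀ then (-1 : L) else 1) with hs
  have hss : s * s = 1 := signMatrix_mul_self L k₀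
  let g : GL (Fin N × Fin M) L := ⟨s, s, hss, hss⟩
  have hmem : g ∈ UnitaryGroup.rationalPair (Fp L) L (IsCMField.complexConj L) N M (Matrix.diagonal dV) (Matrix.diagonal dW) := by
    change g ∈ unitaryGroupOfForm _ _
    rw [mem_unitaryGroupOfForm_iff]
    change (s.map _)ᵀ * (Matrix.diagonal dV ⊗ₖ Matrix.diagonal dW) * s = Matrix.diagonal dV ⊗ₖ Matrix.diagonal dW
    rw [hs, signMatrix_map L k₀, Matrix.diagonal_transpose, Matrix.diagonal_kronecker_diagonal, Matrix.diagonal_mul_diagonal,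
      Matrix.diagonal_mul_diagonal]
    congr 1
    funext k
    split_ifs <;> ring
  refine ⟨⟨g, hmem⟩, rfl, ?_⟩
  apply Subtype.ext
  apply Units.ext
  exact hss

/-! ## §2 The adelic block `G = reindex e (diag σ)` and the corner condition `X_{k₀k₀} = 0` -/

omit [IsCMField L] in
/-- For a rational `γ` with matrix `diag(σ)`, the adelic block of `w₁ = ι(1, γ ⊗ 1)` is `G = diag(σ ∘ e⁻¹)` over `𝔸_L`. [folklore] -/
theorem reindex_sign_eq {γ : GL (Fin N × Fin M) L} (k₀ : Fin N × Fin M)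
    (hγ : (γ : Matrix (Fin N × Fin M) (Fin N × Fin M) L) = Matrix.diagonal (fun k : Fin N × Fin M => if k = k₀ then (-1 : L) else 1)) :
    Matrix.reindex e e ((γ : Matrix (Fin N × Fin M) (Fin N × Fin M) L).map (algebraMap L (AdeleRing (𝓞 L) L))) =
      Matrix.diagonal (fun i : Fin n => if i = e k₀ then (-1 : AdeleRing (𝓞 L) L) else 1) := by
  rw [hγ, Matrix.diagonal_map (map_zero _), Matrix.reindex_apply, Matrix.submatrix_diagonal_equiv]
  congr 1
  funext i
  simp only [Function.comp_apply]
  by_cases h : i = e k₀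
  · rw [if_pos h, if_pos (by rw [h, Equiv.symm_apply_apply]), map_neg, map_one]
  · rw [if_neg h, if_neg (fun h' => h (by rw [← h', Equiv.apply_symm_apply])), map_one]

omit [IsCMField L] in
/-- `1 − diag(σ) = diag(2·𝟙_{k₀})` over `𝔸_L`. [folklore] -/
theorem one_sub_signDiag (i₀ : Fin n) :
    (1 : Matrix (Fin n) (Fin n) (AdeleRing (𝓞 L) L)) - Matrix.diagonal (fun i : Fin n => if i = i₀ then (-1 : AdeleRing (𝓞 L) L) else 1) =
      Matrix.diagonal (fun i : Fin n => if i = i₀ then (2 : AdeleRing (𝓞 L) L) else 0) := by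
  rw [← Matrix.diagonal_one, Matrix.diagonal_sub]
  congr 1
  funext i
  show (1 : AdeleRing (𝓞 L) L) - (if i = i₀ then (-1 : AdeleRing (𝓞 L) L) else 1) = if i = i₀ then (2 : AdeleRing (𝓞 L) L) else 0
  split_ifs <;> norm_num

omit [IsCMField L] in
/-- **THE CORNER CONDITION OF THE RANK-ONE CELL: `(1 − G) X (1 − G) = 0 ⟺ X_{i₀ i₀} = 0`** for `G = diag(σ)` the sign involution at `i₀` (over `𝔸_L`,
where `4` is a unit).  With ★ B2b `isSiegelDelta_conj_unip_iff`: the stabiliser of `P_Δ w₁` in `N_Δ` is the hyperplane `{(blk u)₁₂ (i₀,i₀) = 0}`.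
[cite: MoeglinWaldspurger1995, II.1.7] [cite: GelbartPiatetskishapiroRallis1987, Part A §§1–2] -/
theorem cornerCondition_sign_iff (i₀ : Fin n) (X : Matrix (Fin n) (Fin n) (AdeleRing (𝓞 L) L)) :
    ((1 : Matrix (Fin n) (Fin n) (AdeleRing (𝓞 L) L)) - Matrix.diagonal (fun i : Fin n => if i = i₀ then (-1 : AdeleRing (𝓞 L) L) else 1)) * X *
        ((1 : Matrix (Fin n) (Fin n) (AdeleRing (𝓞 L) L)) - Matrix.diagonal (fun i : Fin n => if i = i₀ then (-1 : AdeleRing (𝓞 L) L) else 1)) = 0 ↔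
      X i₀ i₀ = 0 := by
  rw [one_sub_signDiag]
  constructor
  · intro h
    have h00 := congrFun (congrFun h i₀) i₀
    rw [Matrix.mul_diagonal, Matrix.diagonal_mul, Matrix.zero_apply, if_pos rfl] at h00
    -- `h00 : 2 * X i₀ i₀ * 2 = 0`
    have h4 : (⅟ (2 : AdeleRing (𝓞 L) L)) * (2 * X i₀ i₀ * 2) * (⅟ (2 : AdeleRing (𝓞 L) L)) = X i₀ i₀ := by
      rw [← mul_assoc, ← mul_assoc, invOf_mul_self, one_mul, mul_assoc, mul_invOf_self, mul_one]
    rw [← h4, h00, mul_zero, zero_mul]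
  · intro h
    ext i j
    rw [Matrix.mul_diagonal, Matrix.diagonal_mul, Matrix.zero_apply]
    by_cases hi : i = i₀
    · by_cases hj : j = i₀
      · subst hi; subst hj
        rw [h, mul_zero, zero_mul]
      · rw [if_neg hj, mul_zero]
    · rw [if_neg hi, zero_mul, zero_mul]

omit [IsCMField L] in
/-- `G = diag(σ) ≠ 1` (its `(i₀,i₀)` entry is `−1 ≠ 1` in `𝔸_L ⊇ L`, char 0) — so `w₁ ∉ P_Δ(𝔸)` by ★ B2b `not_isSiegelDelta_iotaGG_one`. [folklore] -/
theorem signDiag_ne_one (i₀ : Fin n) :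
    Matrix.diagonal (fun i : Fin n => if i = i₀ then (-1 : AdeleRing (𝓞 L) L) else 1) ≠ 1 := by
  intro h
  have h00 := congrFun (congrFun h i₀) i₀
  rw [Matrix.diagonal_apply_eq, if_pos rfl, Matrix.one_apply_eq] at h00
  have h2 : (2 : AdeleRing (𝓞 L) L) = 0 := by linear_combination -h00
  have hinj := AdeleRing.algebraMap_injective (𝓞 L) L
  exact two_ne_zero (hinj (by rw [map_ofNat, map_zero, h2]))

end Summit.HodgeConjecture.HodgeConjecture.Cruxes.HLiu418.K2LiuSiegelReflectionSign

end
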